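import Summits.HubbardSuperconductivity.HubbardSuperconductivity.Theorems.AnisotropyChordKnnJacobi

/-!
# Route `AnisotropyChord` / H0 rotor rung, K_{n,n} sibling of XY-LM₀: COMPARISON toolkit for Jacobi top vectors
(prover seat `hubbard-h0-rotor-p1` g13; Lean port of the mechanism of theory seat `hubbard-h0-rotor-theory-1`'s LEMMA R,
THEOREMS.md M14, memo ROTOR-THEORY-11 §163)

* `exists_isTopVector` — a Jacobi matrix with non-negative couplings has a variational top vector (compactness + `|·|`);
* `mlr_sum_le` — monotone-likelihood-ratio dominance of weights ⇒ dominance of means of a non-decreasing function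
  (double-sum proof: `Σ_{k,l} (w_k w'_l − w_l w'_k)(f_l − f_k) ≥ 0`);
* `riccati_compare` — THE RICCATI COMPARISON (LEMMA R's core, division-free): for two Jacobi eigen-systems `(p, c, λ, e)` on
  `m = m' + s` levels and `(p', c', λ', e')` on `m'` levels (aligned at the top), the row-wise budget `λ − p_{k+s} ≤ λ' − p'_k`
  and the coupling dominance `c'_k ≤ c_{k+s}` (non-top rows) give `c_{k+s} R_{k+s} ≤ c'_k R'_k`, hence `R_{k+s} ≤ R'_k` for the
  ratios `R_j = e_{j+1}/e_j`;
* `ratio_chain`, `mean_le_mean_of_adjacent` — adjacent ratio dominance ⇒ MLR ⇒ the mean of any non-decreasing level function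
  climbs.  Pure real analysis on finite sequences; no physics here.
-/

set_option linter.dupNamespace false
set_option autoImplicit false

noncomputable section

open Finset Matrix

namespace Summit.HubbardSuperconductivity.HubbardSuperconductivity.Theorems.AnisotropyChord.Knn

/-! ## Existence of a top vector -/

/-- `ext0` of the entrywise absolute value. [folklore] -/
theorem ext0_abs {m : ℕ} (y : Fin m → ℝ) (k : ℕ) : ext0 (fun i => |y i|) k = |ext0 y k| := by
  unfold ext0; split_ifs <;> simp

/-- Taking absolute values does not decrease the quadratic form of a Jacobi matrix with non-negative couplings. [folklore] -/
theorem quadForm_le_quadForm_abs {m : ℕ} (p c : ℕ → ℝ) (hc : ∀ k, 0 ≤ c k) (y : Fin m → ℝ) :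
    y ⬝ᵥ (jac m p c *ᵥ y) ≤ (fun i => |y i|) ⬝ᵥ (jac m p c *ᵥ (fun i => |y i|)) := by
  rw [jac_quadForm, jac_quadForm]
  apply Finset.sum_le_sum
  intro k _
  rw [ext0_abs, ext0_abs, sq_abs]
  have h1 : ext0 y k * ext0 y (k + 1) ≤ |ext0 y k| * |ext0 y (k + 1)| := by
    rw [← abs_mul]; exact le_abs_self _
  nlinarith [hc k]

/-- **Existence:** a Jacobi matrix on `m ≥ 1` levels with non-negative couplings has a variational top vector
(maximise the quadratic form on the compact unit sphere, then take absolute values). [folklore] -/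
theorem exists_isTopVector {m : ℕ} (hm : 0 < m) (p c : ℕ → ℝ) (hc : ∀ k, 0 ≤ c k) :
    ∃ x : Fin m → ℝ, IsTopVector (jac m p c) x := by
  set A := jac m p c with hA
  set Q : (Fin m → ℝ) → ℝ := fun y => y ⬝ᵥ (A *ᵥ y) with hQ
  have hQc : Continuous Q := by
    apply Continuous.dotProduct continuous_id
    exact Continuous.matrix_mulVec continuous_const continuous_id
  set S : Set (Fin m → ℝ) := {y | y ⬝ᵥ y = 1} with hS
  have hSc : IsClosed S := isClosed_eq (Continuous.dotProduct continuous_id continuous_id) continuous_const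
  have hSb : Bornology.IsBounded S := by
    rw [Metric.isBounded_iff_subset_closedBall (0 : Fin m → ℝ)]
    refine ⟨1, fun y hy => ?_⟩
    rw [mem_closedBall_zero_iff, pi_norm_le_iff_of_nonneg zero_le_one]
    intro i
    rw [Real.norm_eq_abs]
    have hyy : y ⬝ᵥ y = 1 := hy
    have hle : y i * y i ≤ ∑ j, y j * y j :=
      Finset.single_le_sum (f := fun j => y j * y j) (fun j _ => mul_self_nonneg (y j)) (Finset.mem_univ i)
    have : ∑ j, y j * y j = 1 := by simpa [dotProduct] using hyy
    rw [this] at hle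
    exact abs_le_one_iff_mul_self_le_one.mpr hle
  have hScpt : IsCompact S := Metric.isCompact_of_isClosed_isBounded hSc hSb
  set y0 : Fin m → ℝ := Pi.single ⟨0, hm⟩ 1 with hy0
  have hy0S : y0 ∈ S := by
    show y0 ⬝ᵥ y0 = 1
    rw [hy0, dotProduct_single, Pi.single_eq_same, mul_one]
  obtain ⟨y, hyS, hmax⟩ := hScpt.exists_isMaxOn ⟨y0, hy0S⟩ hQc.continuousOn
  have hyy : y ⬝ᵥ y = 1 := hyS
  set x : Fin m → ℝ := fun i => |y i| with hx
  have hxx : x ⬝ᵥ x = 1 := by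
    rw [← hyy]; simp only [dotProduct, hx, abs_mul_abs_self]
  have hQyx : Q y ≤ Q x := quadForm_le_quadForm_abs p c hc y
  refine ⟨x, ?_, fun i => abs_nonneg _, fun z => ?_⟩
  · intro h0
    rw [h0, dotProduct_zero] at hxx
    exact zero_ne_one hxx
  · show Q z * (x ⬝ᵥ x) ≤ Q x * (z ⬝ᵥ z)
    rw [hxx, mul_one]
    by_cases hz : z = 0
    · rw [hz, dotProduct_zero, mul_zero, hQ]
      simp
    · have hzz := dotProduct_self_pos_of_ne_zero hz
      set r := (Real.sqrt (z ⬝ᵥ z))⁻¹ with hr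
      have hr2 : r * r * (z ⬝ᵥ z) = 1 := by
        rw [hr, ← mul_inv, Real.mul_self_sqrt hzz.le, inv_mul_cancel₀ hzz.ne']
      have hz1S : (r • z) ∈ S := by
        show (r • z) ⬝ᵥ (r • z) = 1
        rw [smul_dotProduct, dotProduct_smul, smul_eq_mul, smul_eq_mul, ← mul_assoc, hr2]
      have h1 : Q (r • z) ≤ Q y := hmax hz1S
      have hQrz : Q (r • z) = r * r * Q z := by
        simp only [hQ]
        rw [mulVec_smul, smul_dotProduct, dotProduct_smul, smul_eq_mul, smul_eq_mul, mul_assoc]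
      have hrpos : 0 < r := by rw [hr]; exact inv_pos.mpr (Real.sqrt_pos.mpr hzz)
      have h2 : r * r * Q z ≤ Q x := by linarith
      have h3 : r * r * Q z * (z ⬝ᵥ z) ≤ Q x * (z ⬝ᵥ z) := mul_le_mul_of_nonneg_right h2 hzz.le
      calc Q z = r * r * (z ⬝ᵥ z) * Q z := by rw [hr2, one_mul]
        _ = r * r * Q z * (z ⬝ᵥ z) := by ring
        _ ≤ Q x * (z ⬝ᵥ z) := h3

/-! ## MLR dominance of weights ⇒ dominance of means -/

/-- **MLR ⇒ means:** if weights `w, w'` on `range n` satisfy the likelihood-ratio dominance `w_l w'_k ≤ w_k w'_l` (`k ≤ l`;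
no sign hypothesis is needed) and `f` is non-decreasing, then `(Σ w')(Σ w f) ≤ (Σ w)(Σ w' f)` (double-sum proof). [folklore] -/
theorem mlr_sum_le (n : ℕ) (w w' f : ℕ → ℝ) (hf : ∀ k l, k ≤ l → l < n → f k ≤ f l)
    (hmlr : ∀ k l, k ≤ l → l < n → w l * w' k ≤ w k * w' l) :
    (∑ k ∈ range n, w' k) * (∑ k ∈ range n, w k * f k)
      ≤ (∑ k ∈ range n, w k) * (∑ k ∈ range n, w' k * f k) := by
  set a : ℕ → ℕ → ℝ := fun k l => w k * w' l * (f l - f k) with ha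
  have hT : (∑ k ∈ range n, w k) * (∑ k ∈ range n, w' k * f k)
      - (∑ k ∈ range n, w' k) * (∑ k ∈ range n, w k * f k) = ∑ k ∈ range n, ∑ l ∈ range n, a k l := by
    rw [Finset.sum_mul_sum, mul_comm, Finset.sum_mul_sum, ← Finset.sum_sub_distrib]
    apply Finset.sum_congr rfl
    intro k _
    rw [← Finset.sum_sub_distrib]
    apply Finset.sum_congr rfl
    intro l _
    simp only [ha]; ring
  have hsym : ∑ k ∈ range n, ∑ l ∈ range n, a k l = ∑ k ∈ range n, ∑ l ∈ range n, a l k := Finset.sum_comm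
  have hpair : ∀ k ∈ range n, ∀ l ∈ range n, 0 ≤ a k l + a l k := by
    intro k hk l hl
    have e : a k l + a l k = (w k * w' l - w l * w' k) * (f l - f k) := by simp only [ha]; ring
    rw [e]
    rcases Nat.lt_or_ge l k with hlk | hkl
    · exact mul_nonneg_of_nonpos_of_nonpos (by linarith [hmlr l k hlk.le (mem_range.mp hk)])
        (by linarith [hf l k hlk.le (mem_range.mp hk)])
    · exact mul_nonneg (by linarith [hmlr k l hkl (mem_range.mp hl)]) (by linarith [hf k l hkl (mem_range.mp hl)])
  have h2 : 0 ≤ ∑ k ∈ range n, ∑ l ∈ range n, (a k l + a l k) :=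
    Finset.sum_nonneg fun k hk => Finset.sum_nonneg fun l hl => hpair k hk l hl
  have h3 : ∑ k ∈ range n, ∑ l ∈ range n, (a k l + a l k)
      = (∑ k ∈ range n, ∑ l ∈ range n, a k l) + ∑ k ∈ range n, ∑ l ∈ range n, a l k := by
    rw [← Finset.sum_add_distrib]
    apply Finset.sum_congr rfl; intro k _
    rw [Finset.sum_add_distrib]
  linarith

/-- **Ratio chain:** adjacent ratio dominance `e_{j+s+1} e'_j ≤ e'_{j+1} e_{j+s}` between positive sequences propagates to
all pairs `i ≤ j`: `e_{j+s} e'_i ≤ e'_j e_{i+s}`. [folklore] -/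
theorem ratio_chain {m' s : ℕ} (e e' : ℕ → ℝ) (he : ∀ j, j < m' + s → 0 < e j) (he' : ∀ k, k < m' → 0 < e' k)
    (hadj : ∀ k, k + 1 < m' → e (k + s + 1) * e' k ≤ e' (k + 1) * e (k + s)) :
    ∀ i j, i ≤ j → j < m' → e (j + s) * e' i ≤ e' j * e (i + s) := by
  intro i j hij hj
  induction j, hij using Nat.le_induction with
  | base => rw [mul_comm]
  | succ j hij ih =>
    have ih' := ih (by omega)
    have h1 := hadj j hj
    have hej : 0 < e (j + s) := he _ (by omega)
    have hej' : 0 < e' j := he' _ (by omega)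
    -- multiply the two inequalities and cancel the positive factor `e_{j+s} e'_j`
    have hprod : (e (j + s + 1) * e' i) * (e' j * e (j + s))
        ≤ (e' (j + 1) * e (i + s)) * (e' j * e (j + s)) := by
      calc (e (j + s + 1) * e' i) * (e' j * e (j + s))
          = (e (j + s + 1) * e' j) * (e (j + s) * e' i) := by ring
        _ ≤ (e' (j + 1) * e (j + s)) * (e' j * e (i + s)) :=
            mul_le_mul h1 ih' (mul_nonneg hej.le (he' i (by omega)).le)
              (mul_nonneg (he' _ (by omega)).le hej.le)
        _ = (e' (j + 1) * e (i + s)) * (e' j * e (j + s)) := by ring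
    have : j + 1 + s = j + s + 1 := by ring
    rw [this]
    exact le_of_mul_le_mul_right hprod (mul_pos hej' hej)

/-- **THE RICCATI COMPARISON (core of LEMMA R, division-free).**  Two Jacobi eigen-systems: `(p, c)` on `m = m' + s` levels
with eigen-pair `(λ, e)`, and `(p', c')` on `m'` levels with `(λ', e')`, level `k` of the second aligned with level `k + s` of
the first; positive couplings, positive eigenvectors.  If on every NON-TOP row `k + 1 < m'` the budget inequality
`λ − p_{k+s} ≤ λ' − p'_k` and the coupling dominance `c'_k ≤ c_{k+s}` hold, then `c_{k+s} e_{k+s+1} e'_k ≤ c'_k e'_{k+1} e_{k+s}`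
(i.e. `c_{k+s} R_{k+s} ≤ c'_k R'_k`) on every non-top row — bottom-up induction on the Riccati recursion
`c_j R_j = (λ − p_j) − c_{j−1}/R_{j−1}`.
[conjecture: theory seat hubbard-h0-rotor-theory-1, cycle 11 — LEMMA R (M14), paper-proved; Lean proof here] -/
theorem riccati_compare {m m' s : ℕ} (hms : m = m' + s) {p c p' c' : ℕ → ℝ} {lam lam' : ℝ} {e e' : ℕ → ℝ}
    (hrow : ∀ j, j < m → lam * e j = p j * e j + c j * e (j + 1) + (if j = 0 then 0 else c (j - 1) * e (j - 1)))
    (hrow' : ∀ k, k < m' → lam' * e' k = p' k * e' k + c' k * e' (k + 1)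
      + (if k = 0 then 0 else c' (k - 1) * e' (k - 1)))
    (he : ∀ j, j < m → 0 < e j) (he' : ∀ k, k < m' → 0 < e' k) (henn : ∀ j, 0 ≤ e j)
    (hc : ∀ j, j + 1 < m → 0 < c j)
    (H1 : ∀ k, k + 1 < m' → lam - p (k + s) ≤ lam' - p' k) (H2 : ∀ k, k + 1 < m' → c' k ≤ c (k + s)) :
    ∀ k, k + 1 < m' → c (k + s) * e (k + s + 1) * e' k ≤ c' k * e' (k + 1) * e (k + s) := by
  intro k
  induction k with
  | zero =>
    intro h1
    simp only [zero_add]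
    have r' := hrow' 0 (by omega)
    simp only [if_true, add_zero] at r'
    have r := hrow s (by omega)
    -- the lower-neighbour term of row `s` is non-negative
    have hlow : 0 ≤ (if s = 0 then 0 else c (s - 1) * e (s - 1)) := by
      split_ifs with hs
      · exact le_rfl
      · exact mul_nonneg (hc (s - 1) (by omega)).le (henn _)
    have hes : 0 < e s := he s (by omega)
    have he0 : 0 < e' 0 := he' 0 (by omega)
    have hb := H1 0 h1
    simp only [zero_add] at hb
    -- c_s e_{s+1} ≤ (λ − p_s) e_s ≤ (λ' − p'_0) e_s and c'_0 e'_1 = (λ' − p'_0) e'_0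
    have e1 : c s * e (s + 1) ≤ (lam - p s) * e s := by linarith
    have e2 : (lam - p s) * e s ≤ (lam' - p' 0) * e s := mul_le_mul_of_nonneg_right hb hes.le
    have e3 : c' 0 * e' (0 + 1) = (lam' - p' 0) * e' 0 := by linarith
    calc c s * e (s + 1) * e' 0 ≤ (lam' - p' 0) * e s * e' 0 :=
          mul_le_mul_of_nonneg_right (e1.trans e2) he0.le
      _ = c' 0 * e' (0 + 1) * e s := by rw [e3]; ring
  | succ k ih =>
    intro hk2
    have ih' := ih (by omega)
    have r' := hrow' (k + 1) (by omega)
    have r := hrow (k + 1 + s) (by omega)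
    simp only [Nat.succ_ne_zero, if_false, Nat.add_sub_cancel] at r'
    have hne : k + 1 + s ≠ 0 := by omega
    simp only [hne, if_false] at r
    have eidx1 : k + 1 + s - 1 = k + s := by omega
    have eidx2 : k + 1 + s = k + s + 1 := by ring
    rw [eidx1] at r
    rw [eidx2] at r ⊢
    have hek : 0 < e (k + s + 1) := he _ (by omega)
    have hek' : 0 < e' (k + 1) := he' _ (by omega)
    have hb := H1 (k + 1) hk2
    rw [eidx2] at hb
    have hcc := H2 k (by omega)
    have hcc1 := H2 (k + 1) hk2
    -- (i) budget on the diagonal terms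
    have d1 : (lam - p (k + s + 1)) * e (k + s + 1) * e' (k + 1)
        ≤ (lam' - p' (k + 1)) * e' (k + 1) * e (k + s + 1) := by
      have := mul_le_mul_of_nonneg_right hb (mul_nonneg hek.le hek'.le)
      nlinarith
    -- (ii) lower-neighbour terms: c'_k e'_k e_{k+s+1} ≤ c_{k+s} e_{k+s} e'_{k+1}
    have d2 : c' k * e' k * e (k + s + 1) ≤ c (k + s) * e (k + s) * e' (k + 1) := by
      have hekk : 0 ≤ e' k * e (k + s + 1) := mul_nonneg (he' k (by omega)).le hek.le
      have s1 : c' k * e' k * e (k + s + 1) ≤ c (k + s) * e' k * e (k + s + 1) := by nlinarith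
      have s2 : c' k * e' (k + 1) * e (k + s) ≤ c (k + s) * e' (k + 1) * e (k + s) := by
        have : 0 ≤ e' (k + 1) * e (k + s) := mul_nonneg hek'.le (he _ (by omega)).le
        nlinarith
      nlinarith
    -- combine through the two row equations
    have er : c (k + s + 1) * e (k + s + 1 + 1)
        = (lam - p (k + s + 1)) * e (k + s + 1) - c (k + s) * e (k + s) := by linarith
    have er' : c' (k + 1) * e' (k + 1 + 1)
        = (lam' - p' (k + 1)) * e' (k + 1) - c' k * e' k := by linarith
    calc c (k + s + 1) * e (k + s + 1 + 1) * e' (k + 1)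
        = ((lam - p (k + s + 1)) * e (k + s + 1) - c (k + s) * e (k + s)) * e' (k + 1) := by rw [er]
      _ ≤ ((lam' - p' (k + 1)) * e' (k + 1) - c' k * e' k) * e (k + s + 1) := by nlinarith
      _ = c' (k + 1) * e' (k + 1 + 1) * e (k + s + 1) := by rw [er']

/-- Corollary: under the hypotheses of `riccati_compare` (and coupling dominance), the adjacent ratio dominance
`e_{k+s+1} e'_k ≤ e'_{k+1} e_{k+s}` holds on every non-top row. [folklore] -/
theorem adjacent_of_riccati {m' s : ℕ} {c c' e e' : ℕ → ℝ}
    (hric : ∀ k, k + 1 < m' → c (k + s) * e (k + s + 1) * e' k ≤ c' k * e' (k + 1) * e (k + s))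
    (hc' : ∀ k, k + 1 < m' → 0 < c' k) (H2 : ∀ k, k + 1 < m' → c' k ≤ c (k + s))
    (henn : ∀ j, 0 ≤ e j) (henn' : ∀ k, 0 ≤ e' k) :
    ∀ k, k + 1 < m' → e (k + s + 1) * e' k ≤ e' (k + 1) * e (k + s) := by
  intro k hk
  have h := hric k hk
  have hpos := hc' k hk
  have h1 : c' k * (e (k + s + 1) * e' k) ≤ c (k + s) * e (k + s + 1) * e' k := by
    have : 0 ≤ e (k + s + 1) * e' k := mul_nonneg (henn _) (henn' _)
    nlinarith [H2 k hk]
  have h2 : c' k * (e (k + s + 1) * e' k) ≤ c' k * (e' (k + 1) * e (k + s)) := by nlinarith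
  exact le_of_mul_le_mul_left h2 hpos

/-- **Means climb under adjacent ratio dominance:** for positive sequences `e` (on `m' + s` levels) and `e'` (on `m'`
levels, aligned at the top) with `e_{k+s+1} e'_k ≤ e'_{k+1} e_{k+s}`, and a non-decreasing level function `f`, the
`e²`-weighted mean of `f` is at most the `e'²`-weighted mean of the shifted `f`. [folklore] -/
theorem mean_le_mean_of_adjacent {m' s : ℕ} (hm' : 0 < m') (e e' f : ℕ → ℝ)
    (he : ∀ j, j < m' + s → 0 < e j) (he' : ∀ k, k < m' → 0 < e' k)
    (hf : ∀ k l, k ≤ l → l < m' + s → f k ≤ f l)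
    (hadj : ∀ k, k + 1 < m' → e (k + s + 1) * e' k ≤ e' (k + 1) * e (k + s)) :
    (∑ j ∈ range (m' + s), f j * e j ^ 2) / (∑ j ∈ range (m' + s), e j ^ 2)
      ≤ (∑ k ∈ range m', f (k + s) * e' k ^ 2) / (∑ k ∈ range m', e' k ^ 2) := by
  set w : ℕ → ℝ := fun j => e j ^ 2 with hw
  set w' : ℕ → ℝ := fun j => if s ≤ j then e' (j - s) ^ 2 else 0 with hw'
  have hwnn : ∀ j, 0 ≤ w j := fun j => sq_nonneg _
  have hw'nn : ∀ j, 0 ≤ w' j := by intro j; simp only [hw']; split_ifs <;> positivity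
  -- re-index the primed sums onto the long range
  have hre : ∀ g : ℕ → ℝ, ∑ j ∈ range (m' + s), w' j * g j = ∑ k ∈ range m', e' k ^ 2 * g (k + s) := by
    intro g
    rw [add_comm m' s, Finset.sum_range_add]
    have h0 : ∑ j ∈ range s, w' j * g j = 0 := by
      apply Finset.sum_eq_zero; intro j hj
      have : ¬ s ≤ j := not_le.mpr (mem_range.mp hj)
      simp [hw', this]
    rw [h0, zero_add]
    apply Finset.sum_congr rfl; intro k _
    simp [hw', add_comm s k]
  have hchain := ratio_chain e e' he he' hadj
  have hmlr : ∀ k l, k ≤ l → l < m' + s → w l * w' k ≤ w k * w' l := by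
    intro k l hkl hl
    by_cases hk : s ≤ k
    · have hl' : s ≤ l := hk.trans hkl
      simp only [hw, hw', hk, hl', if_true]
      obtain ⟨i, rfl⟩ := Nat.exists_eq_add_of_le hk
      obtain ⟨j, rfl⟩ := Nat.exists_eq_add_of_le hl'
      simp only [Nat.add_sub_cancel_left]
      have hij : i ≤ j := by omega
      have hc := hchain i j hij (by omega)
      rw [add_comm s j, add_comm s i] at *
      have hnn1 : 0 ≤ e (j + s) * e' i := mul_nonneg (he _ (by omega)).le (he' _ (by omega)).le
      calc e (j + s) ^ 2 * e' i ^ 2 = (e (j + s) * e' i) ^ 2 := by ring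
        _ ≤ (e' j * e (i + s)) ^ 2 := pow_le_pow_left₀ hnn1 hc 2
        _ = e (i + s) ^ 2 * e' j ^ 2 := by ring
    · have : w' k = 0 := by simp [hw', hk]
      rw [this, mul_zero]; exact mul_nonneg (hwnn k) (hw'nn l)
  have key := mlr_sum_le (m' + s) w w' f hf hmlr
  rw [hre f, show (∑ j ∈ range (m' + s), w' j) = ∑ k ∈ range m', e' k ^ 2 by
    simpa using hre (fun _ => 1)] at key
  have hpos : 0 < ∑ j ∈ range (m' + s), e j ^ 2 := by
    apply Finset.sum_pos (fun j hj => pow_pos (he j (mem_range.mp hj)) 2)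
    exact ⟨0, mem_range.mpr (by omega)⟩
  have hpos' : 0 < ∑ k ∈ range m', e' k ^ 2 := by
    apply Finset.sum_pos (fun k hk => pow_pos (he' k (mem_range.mp hk)) 2)
    exact ⟨0, mem_range.mpr hm'⟩
  rw [div_le_div_iff₀ hpos hpos']
  have e1 : ∑ j ∈ range (m' + s), f j * e j ^ 2 = ∑ j ∈ range (m' + s), w j * f j := by
    apply Finset.sum_congr rfl; intro j _; simp only [hw]; ring
  have e2 : ∑ k ∈ range m', f (k + s) * e' k ^ 2 = ∑ k ∈ range m', e' k ^ 2 * f (k + s) := by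
    apply Finset.sum_congr rfl; intro k _; ring
  rw [e1, e2]
  linarith

end Summit.HubbardSuperconductivity.HubbardSuperconductivity.Theorems.AnisotropyChord.Knn
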